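import Literature.Claims.NS.Wu2026
import Mathlib.Analysis.SpecificLimits.Basic
import Mathlib.MeasureTheory.Integral.Lebesgue.Add
import HarnessLib

/-!
# C177 `Wu2026` — a summable weight adapted to a countable family of sets and local bounds
# (tool for sub-binder (E) of `Step_construct`; cell `pub/ns-inputs`, seat `ns-in-wu-con`; route
# business of `GaldiLiouvilleGate`, item stmt-NavierStokesRegularity-0897)

To extract ONE weakly convergent subsequence of the gradients `∇V_j` on the whole exterior region
`{|y| > 1}` (piece (E), (3.35) p.13) from bounds that are only uniform on each ball of a countable
cover `(B_k)` — `∫_{B_k} |∇V_j|^{9/5} ≤ C_k` — one passes to the finite measure `w · dy` with a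
weight `w = Σ_k ε_k 1_{B_k}`, `ε_k = 2^{-k-1}/((C_k⁺ + 1)(|B_k| + 1))`: then `w ≤ 1`, `∫ w ≤ 1`,
`w ≥ ε_k > 0` on `B_k`, and `∫ w g ≤ 1` whenever `∫_{B_k} g ≤ C_k` for all `k`
(`exists_summable_weight`). This replaces the diagonal argument over the exhaustion («nested
exhaustion … diagonal subsequence», p.11 l.44–50, reused on p.13) by a single application of weak
compactness in `L^{9/5}(w dy)`.

Theorems only, standard axioms, no `sorry`.

WHAT THIS IS NOT: not a proof of `Step_construct`; not a claim about NS regularity or blow-up; not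
a claim about any author beyond the typed locator.
-/

set_option linter.dupNamespace false

noncomputable section

open MeasureTheory Set Filter Topology
open scoped ENNReal NNReal Topology

namespace Summit.NavierStokesRegularity.NavierStokesRegularity.Theorems.Wu2026Salvage

open Literature.Claims.NS.Wu2026

/-- `Σ_k 2^{-(k+1)} = 1` in `ℝ≥0∞`. [folklore] -/
theorem tsum_half_pow_succ : ∑' k : ℕ, (2⁻¹ : ℝ≥0∞) ^ (k + 1) = 1 := by
  rw [ENNReal.tsum_geometric_add_one, ENNReal.one_sub_inv_two, inv_inv,
    ENNReal.inv_mul_cancel (by norm_num) (by norm_num)]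

/-- **A summable weight adapted to a countable family of sets and constants** (the device replacing
the diagonal subsequence of p.11 l.44–50 / p.13): for measurable sets `B_k` of finite measure and
reals `C_k` there are `w : ℝ³ → [0, ∞]` measurable and `ε_k ∈ (0, 1]` with `w ≤ 1`, `∫ w ≤ 1`,
`ε_k ≤ w` on `B_k`, and `∫ w g ≤ 1` for every measurable `g ≥ 0` with `∫_{B_k} g ≤ C_k` for all `k`.
[cite: Wu2026, (3.28)/(3.35) p.11 l.44–50, p.13] -/
theorem exists_summable_weight (B : ℕ → Set E3) (hB : ∀ k, MeasurableSet (B k))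
    (hBfin : ∀ k, volume (B k) ≠ ∞) (C : ℕ → ℝ) :
    ∃ (w : E3 → ℝ≥0∞) (ε : ℕ → ℝ≥0∞), Measurable w ∧ (∀ y, w y ≤ 1) ∧
      (∀ k, ε k ≠ 0) ∧ (∀ k, ε k ≤ 1) ∧ (∀ k y, y ∈ B k → ε k ≤ w y) ∧
      (∫⁻ y, w y ≤ 1) ∧
      (∀ g : E3 → ℝ≥0∞, Measurable g → (∀ k, ∫⁻ y in B k, g y ≤ ENNReal.ofReal (C k)) →
        ∫⁻ y, w y * g y ≤ 1) := by
  set θ : ℕ → ℝ := fun k => 1 / ((max (C k) 0 + 1) * ((volume (B k)).toReal + 1)) with hθ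
  have hθpos : ∀ k, 0 < θ k := fun k => by
    have h1 : 0 < max (C k) 0 + 1 := by positivity
    have h2 : 0 < (volume (B k)).toReal + 1 := by positivity
    positivity
  have ha : ∀ k, 1 ≤ max (C k) 0 + 1 := fun k => by linarith [le_max_right (C k) 0]
  have hb : ∀ k, 0 ≤ (volume (B k)).toReal := fun k => ENNReal.toReal_nonneg
  have hab : ∀ k, 0 < (max (C k) 0 + 1) * ((volume (B k)).toReal + 1) := fun k => by
    have := ha k; have := hb k; positivity
  have hθk : ∀ k, θ k = 1 / ((max (C k) 0 + 1) * ((volume (B k)).toReal + 1)) := fun k => rfl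
  have hθle : ∀ k, θ k ≤ 1 := fun k => by
    rw [hθk, div_le_one (hab k)]
    nlinarith [ha k, hb k]
  have hθv : ∀ k, θ k * (volume (B k)).toReal ≤ 1 := fun k => by
    rw [hθk, one_div, inv_mul_le_iff₀ (hab k), mul_one]
    nlinarith [ha k, hb k]
  have hθC : ∀ k, θ k * C k ≤ 1 := fun k => by
    rw [hθk, one_div, inv_mul_le_iff₀ (hab k), mul_one]
    nlinarith [ha k, hb k, le_max_left (C k) 0]
  set ε : ℕ → ℝ≥0∞ := fun k => (2⁻¹ : ℝ≥0∞) ^ (k + 1) * ENNReal.ofReal (θ k) with hε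
  set w : E3 → ℝ≥0∞ := fun y => ∑' k, (B k).indicator (fun _ => ε k) y with hw
  have hhalf : ∀ k, (2⁻¹ : ℝ≥0∞) ^ (k + 1) ≠ 0 := fun k => pow_ne_zero _ (by norm_num)
  have hhalf' : ∀ k, (2⁻¹ : ℝ≥0∞) ^ (k + 1) ≠ ∞ := fun k => ENNReal.pow_ne_top (by norm_num)
  have hεle : ∀ k, ε k ≤ (2⁻¹ : ℝ≥0∞) ^ (k + 1) := fun k => by
    calc ε k = (2⁻¹ : ℝ≥0∞) ^ (k + 1) * ENNReal.ofReal (θ k) := rfl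
      _ ≤ (2⁻¹ : ℝ≥0∞) ^ (k + 1) * 1 := by
          gcongr; rw [← ENNReal.ofReal_one]; exact ENNReal.ofReal_le_ofReal (hθle k)
      _ = _ := mul_one _
  have hind_meas : ∀ k, Measurable fun y => (B k).indicator (fun _ => ε k) y := fun k =>
    measurable_const.indicator (hB k)
  have hwm : Measurable w := by
    have hrepr : w = fun y => ⨆ s : Finset ℕ, ∑ k ∈ s, (B k).indicator (fun _ => ε k) y := by
      funext y; exact ENNReal.tsum_eq_iSup_sum
    rw [hrepr]
    exact Measurable.iSup fun s => Finset.measurable_sum s fun k _ => hind_meas k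
  refine ⟨w, ε, hwm, fun y => ?_, fun k => ?_, fun k => ?_,
    fun k y hy => ?_, ?_, fun g hg hgk => ?_⟩
  · -- `w ≤ 1`
    calc w y ≤ ∑' k, (2⁻¹ : ℝ≥0∞) ^ (k + 1) := ENNReal.tsum_le_tsum fun k => by
          by_cases hyk : y ∈ B k
          · rw [indicator_of_mem hyk]; exact hεle k
          · rw [indicator_of_notMem hyk]; exact bot_le
      _ = 1 := tsum_half_pow_succ
  · exact mul_ne_zero (hhalf k) ((ENNReal.ofReal_pos.2 (hθpos k)).ne')
  · exact (hεle k).trans (pow_le_one₀ bot_le (by norm_num))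
  · calc ε k = (B k).indicator (fun _ => ε k) y := by rw [indicator_of_mem hy]
      _ ≤ w y := ENNReal.le_tsum k
  · -- `∫ w ≤ 1`
    rw [lintegral_tsum fun k => (hind_meas k).aemeasurable]
    calc ∑' k, ∫⁻ y, (B k).indicator (fun _ => ε k) y
        = ∑' k, ε k * volume (B k) := by
          congr 1; funext k; rw [lintegral_indicator (hB k), setLIntegral_const]
      _ ≤ ∑' k, (2⁻¹ : ℝ≥0∞) ^ (k + 1) := ENNReal.tsum_le_tsum fun k => by
          rw [hε, mul_assoc]
          calc (2⁻¹ : ℝ≥0∞) ^ (k + 1) * (ENNReal.ofReal (θ k) * volume (B k))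
              ≤ (2⁻¹ : ℝ≥0∞) ^ (k + 1) * 1 := by
                gcongr
                rw [← ENNReal.ofReal_toReal (hBfin k), ← ENNReal.ofReal_mul (hθpos k).le,
                  ← ENNReal.ofReal_one]
                exact ENNReal.ofReal_le_ofReal (hθv k)
            _ = _ := mul_one _
      _ = 1 := tsum_half_pow_succ
  · -- `∫ w g ≤ 1`
    have hterm : ∀ k, Measurable fun y => (B k).indicator (fun _ => ε k) y * g y := fun k =>
      (hind_meas k).mul hg
    have hexp : (fun y => w y * g y) = fun y => ∑' k, (B k).indicator (fun _ => ε k) y * g y := by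
      funext y
      rw [hw]
      exact ENNReal.tsum_mul_right.symm
    rw [hexp, lintegral_tsum fun k => (hterm k).aemeasurable]
    calc ∑' k, ∫⁻ y, (B k).indicator (fun _ => ε k) y * g y
        = ∑' k, ε k * ∫⁻ y in B k, g y := by
          congr 1; funext k
          have : (fun y => (B k).indicator (fun _ => ε k) y * g y) =
              fun y => (B k).indicator (fun y => ε k * g y) y := by
            funext y
            by_cases hy : y ∈ B k
            · rw [indicator_of_mem hy, indicator_of_mem hy]
            · rw [indicator_of_notMem hy, indicator_of_notMem hy, zero_mul]
          rw [this, lintegral_indicator (hB k), lintegral_const_mul _ hg]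
      _ ≤ ∑' k, (2⁻¹ : ℝ≥0∞) ^ (k + 1) := ENNReal.tsum_le_tsum fun k => by
          calc ε k * ∫⁻ y in B k, g y ≤ ε k * ENNReal.ofReal (C k) := by gcongr; exact hgk k
            _ = (2⁻¹ : ℝ≥0∞) ^ (k + 1) * (ENNReal.ofReal (θ k) * ENNReal.ofReal (C k)) := by
                rw [hε, mul_assoc]
            _ ≤ (2⁻¹ : ℝ≥0∞) ^ (k + 1) * 1 := by
                gcongr
                rw [← ENNReal.ofReal_mul (hθpos k).le, ← ENNReal.ofReal_one]
                exact ENNReal.ofReal_le_ofReal (hθC k)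
            _ = _ := mul_one _
      _ = 1 := tsum_half_pow_succ

end Summit.NavierStokesRegularity.NavierStokesRegularity.Theorems.Wu2026Salvage

end

-- WHAT THIS IS NOT: not a claim about NS regularity or blow-up; not a claim about any author beyond the typed locator.
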